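import Mathlib
import HarnessLib
import Summits.HubbardSuperconductivity.HubbardSuperconductivity.Theorems.KLProgrammeKLRegimeEnginePairTransferMemberPHCrossedSigned
import Summits.HubbardSuperconductivity.HubbardSuperconductivity.Theorems.KLProgrammeKLRegimeEnginePairTransferPHSignedGeneric

/-!
# Route `KLProgramme` — ENGINE item stmt-HubbardSuperconductivity-20437 `KLRegimeEngineV17F2`, class-#5 STEP (X).3 rows form: THE SIGNED CROSSED PH ROW FOR A
# GENERIC PARTNER WEIGHT AND KERNEL, and the ADJACENT-PAIR crossed `D`-row `Rx₁` assembled (cell gate-hubbard-kl, seat hubbard-kl-k3c2-p2 g17)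

Generic form of `klms_memberPH_crossed_norm_le` (…MemberPHCrossedSigned): partner weight `w` with radial profile `d`, resolved kernel `F`, momentum-only pin `F₀`;
then the `D`-row `Rx₁` of the adjacent pair `(j, n+1)` (`D = s_{n+1,j} − s_{n+1,n+1}`, profile `klPhiC Λ_j Λₙ₊₁`) through `klms_pinned_bubble_norm_le_gen`
(…PHSignedGeneric).

* **`klms_weighted_crossed_norm_le`** — `‖S‖ ≤ |βL²|²(‖T_B‖ + ‖T_A‖) + ε·(256/3)(βL²)²/Λ(t)²·Σ|w|‖ĝ‖` (`16π/β ≤ Λₙ₊₁`, `M ≥ β·4Λₙ₊₁/(2π)+1`);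
* **`klms_dLine_adjacent_crossed_signed_le`** — `‖S_{D,x}‖ ≤ (βL²)²(βL²·Row(|−2π/β| + G|p_q̃|) + βL²·Row(|2π/β| + G|p_q̃|)) + ε·flat`, `q̃ = Q_m − x − y`.

Pure composition; nothing about the model's effective action is asserted; nothing asserts (X).3, (c), K3 or superconductivity.
-/

noncomputable section

namespace Summit.HubbardSuperconductivity.HubbardSuperconductivity.Theorems.KLRegimeSplit

set_option linter.dupNamespace false -- summit = problem name (single-conjunct summit), D-0017

open Real Set Finset Complex Literature.MathematicalPhysics.QuantumLattice
open Literature.Probability.LatticeModels hiding torusSupNorm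
open Literature.MathematicalPhysics.QuantumLattice.BandSectorCounting
open Summit.HubbardSuperconductivity.HubbardSuperconductivity.Theorems.KLProgrammeLegKernels
open Summit.HubbardSuperconductivity.HubbardSuperconductivity.Theorems.KLRegimeWick
open Summit.HubbardSuperconductivity.HubbardSuperconductivity.Theorems.TwoPointAssembly
open Summit.HubbardSuperconductivity.HubbardSuperconductivity.Theorems.DispersionFlow
open Summit.HubbardSuperconductivity.HubbardSuperconductivity.Theorems.PerturbedFermiCurve

variable {L M : ℕ} [NeZero L] [NeZero M] (β μ : ℝ) (K : TrigPolyC4v)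

/-! ## §1 The generic crossed row -/

/-- **GENERIC SIGNED CROSSED ROW, SPLIT**: partner weight `w` with radial profile `d` (line identity `hwd`), slice `Ẇ_{Λ(t)}`, resolved kernel `F`, momentum-only
pin `F₀`, flatness `ε` on `ω_i² ≤ (5Λₙ₊₁)²` for partner frequencies `m_{i′} + 1 = m_i`; `16π/β ≤ Λₙ₊₁`, `M ≥ β·4Λₙ₊₁/(2π) + 1`. -/
theorem klms_weighted_crossed_norm_le (hβ : 0 < β) (n : ℕ) {t : ℝ} (ht : t ∈ Icc (0 : ℝ) 1) (hβn : 16 * π / β ≤ klScale klE0 (n + 1))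
    (hM : β * (4 * klScale klE0 (n + 1)) / (2 * Real.pi) + 1 ≤ M)
    (w : FreqMomentum L M → ℝ) (d : ℝ → ℂ)
    (hwd : ∀ p : FreqMomentum L M, (((w p : ℝ)) : ℂ) * ((((β * (L : ℝ) ^ 2 : ℝ)) : ℂ) * propCT L M β μ K p) =
      (((β * (L : ℝ) ^ 2 : ℝ)) : ℂ) * klfb_prop d (matsubaraFreq β M p.1) (nambuXiCT L μ K p.2))
    (Wd : ℝ → FreqMomentum L M → ℝ) (hWd : Wd = fun t k => deriv (fun Λ' : ℝ => hubbardCutoffWeightCT L M β μ K Λ' k) (klScale klE0 n + t * (klScale klE0 (n + 1) - klScale klE0 n)))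
    (F : FreqMomentum L M → FreqMomentum L M → ℂ) (F₀ : TorusSite 2 L → TorusSite 2 L → ℂ) (Qm x y : TorusSite 2 L) {ε : ℝ} (hε : 0 ≤ ε)
    (hflat : ∀ (i i' : MatsubaraIdx M) (k k' : TorusSite 2 L), matsubaraInt M i' + 1 = matsubaraInt M i →
      matsubaraFreq β M i ^ 2 ≤ (5 * klScale klE0 (n + 1)) ^ 2 → ‖F (i, k) (i', k') - F₀ k k'‖ ≤ ε) :
    ‖∑ p : FreqMomentum L M, ∑ p' : FreqMomentum L M,
        if matsubaraInt M p'.1 + matsubaraInt M (omega0 M) + matsubaraInt M (omega0 M) + 1 = matsubaraInt M p.1 ∧ p'.2 = p.2 + Qm - x - y then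
          ((((((w p) : ℝ) : ℂ) * (((β * (L : ℝ) ^ 2 : ℝ) : ℂ) * propCT L M β μ K p)) * ((((Wd t p') : ℝ) : ℂ) * (((β * (L : ℝ) ^ 2 : ℝ) : ℂ) * propCT L M β μ K p'))) +
              (((((Wd t p) : ℝ) : ℂ) * (((β * (L : ℝ) ^ 2 : ℝ) : ℂ) * propCT L M β μ K p)) * ((((w p') : ℝ) : ℂ) * (((β * (L : ℝ) ^ 2 : ℝ) : ℂ) * propCT L M β μ K p')))) *
            F p p'
        else 0‖ ≤
      (β * (L : ℝ) ^ 2) ^ 2 *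
          (‖∑ p : FreqMomentum L M, F₀ p.2 (p.2 + (Qm - x - y)) *
                (klfb_prop (klWdC (klScale klE0 n + t * (klScale klE0 (n + 1) - klScale klE0 n))) (matsubaraFreq β M p.1) (nambuXiCT L μ K p.2) *
                  klfb_prop d (matsubaraFreq β M p.1 + -(2 * π / β)) (nambuXiCT L μ K (p.2 + (Qm - x - y))))‖ +
            ‖∑ p : FreqMomentum L M, F₀ (p.2 + -(Qm - x - y)) p.2 *
                (klfb_prop (klWdC (klScale klE0 n + t * (klScale klE0 (n + 1) - klScale klE0 n))) (matsubaraFreq β M p.1) (nambuXiCT L μ K p.2) *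
                  klfb_prop d (matsubaraFreq β M p.1 + 2 * π / β) (nambuXiCT L μ K (p.2 + -(Qm - x - y))))‖) +
        ε * (256 / 3 * (β * (L : ℝ) ^ 2) ^ 2 / (klScale klE0 n + t * (klScale klE0 (n + 1) - klScale klE0 n)) ^ 2 *
          ∑ p : FreqMomentum L M, |w p| * ‖propCT L M β μ K p‖) := by
  set Λt : ℝ := klScale klE0 n + t * (klScale klE0 (n + 1) - klScale klE0 n) with hΛt
  set q : TorusSite 2 L := Qm - x - y with hq
  obtain ⟨hlo, hhi⟩ := scaleAt_mem n ht
  have hΛ1 := klth_klScale_pos (n + 1)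
  have hΛpos : 0 < Λt := hΛ1.trans_le hlo
  -- kernel product, pinned copy, lines
  set X : FreqMomentum L M → FreqMomentum L M → ℂ := fun p p' => F p p' with hX
  set X₀ : TorusSite 2 L → TorusSite 2 L → ℂ := fun k k' => F₀ k k' with hX₀
  set G : FreqMomentum L M → ℂ := fun p => (((β * (L : ℝ) ^ 2 : ℝ)) : ℂ) * propCT L M β μ K p with hG
  set lW : FreqMomentum L M → ℂ := fun p => (((Wd t p : ℝ)) : ℂ) * G p with hlW
  set lΦ : FreqMomentum L M → ℂ := fun p => (((w p : ℝ)) : ℂ) * G p with hlΦ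
  set ln : FreqMomentum L M → FreqMomentum L M → ℂ := fun p p' => lΦ p * lW p' + lW p * lΦ p' with hln
  set C : FreqMomentum L M → FreqMomentum L M → Prop := fun p p' =>
    matsubaraInt M p'.1 + matsubaraInt M (omega0 M) + matsubaraInt M (omega0 M) + 1 = matsubaraInt M p.1 ∧ p'.2 = p.2 + Qm - x - y with hC
  -- the summand as `ite C (ln·X₀) + ite C (ln·(X − X₀))`
  have hgoal : (∑ p : FreqMomentum L M, ∑ p' : FreqMomentum L M,
        if matsubaraInt M p'.1 + matsubaraInt M (omega0 M) + matsubaraInt M (omega0 M) + 1 = matsubaraInt M p.1 ∧ p'.2 = p.2 + Qm - x - y then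
          ((((((w p) : ℝ) : ℂ) * (((β * (L : ℝ) ^ 2 : ℝ) : ℂ) * propCT L M β μ K p)) * ((((Wd t p') : ℝ) : ℂ) * (((β * (L : ℝ) ^ 2 : ℝ) : ℂ) * propCT L M β μ K p'))) +
              (((((Wd t p) : ℝ) : ℂ) * (((β * (L : ℝ) ^ 2 : ℝ) : ℂ) * propCT L M β μ K p)) * ((((w p') : ℝ) : ℂ) * (((β * (L : ℝ) ^ 2 : ℝ) : ℂ) * propCT L M β μ K p')))) *
            F p p'
        else 0) =
      (∑ p : FreqMomentum L M, ∑ p' : FreqMomentum L M, if C p p' then ln p p' * X₀ p.2 p'.2 else 0) +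
        ∑ p : FreqMomentum L M, ∑ p' : FreqMomentum L M, if C p p' then ln p p' * (X p p' - X₀ p.2 p'.2) else 0 := by
    rw [← Finset.sum_add_distrib]
    refine Finset.sum_congr rfl fun p _ => ?_
    rw [← Finset.sum_add_distrib]
    refine Finset.sum_congr rfl fun p' _ => ?_
    simp only [hC]
    split_ifs
    · simp only [hln, hlW, hlΦ, hX, hX₀, hG]; ring
    · simp
  rw [hgoal]
  refine (norm_add_le _ _).trans (add_le_add ?_ ?_)
  · ----------------------------------------------------------------- the pinned part
    have hsplit : (∑ p : FreqMomentum L M, ∑ p' : FreqMomentum L M, if C p p' then ln p p' * X₀ p.2 p'.2 else 0) =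
        (∑ p : FreqMomentum L M, lW p * ∑ p' : FreqMomentum L M, if C p p' then lΦ p' * X₀ p.2 p'.2 else 0) +
          ∑ p' : FreqMomentum L M, lW p' * ∑ p : FreqMomentum L M, if C p p' then lΦ p * X₀ p.2 p'.2 else 0 := by
      have e1 : ∀ p p', (if C p p' then ln p p' * X₀ p.2 p'.2 else 0) =
          (if C p p' then lW p * (lΦ p' * X₀ p.2 p'.2) else 0) + (if C p p' then lW p' * (lΦ p * X₀ p.2 p'.2) else 0) := by
        intro p p'; split_ifs
        · simp only [hln]; ring
        · simp
      simp_rw [e1, Finset.sum_add_distrib]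
      congr 1
      · refine Finset.sum_congr rfl fun p _ => ?_
        rw [Finset.mul_sum]
        refine Finset.sum_congr rfl fun p' _ => ?_
        split_ifs <;> simp
      · rw [Finset.sum_comm]
        refine Finset.sum_congr rfl fun p' _ => ?_
        rw [Finset.mul_sum]
        refine Finset.sum_congr rfl fun p _ => ?_
        split_ifs <;> simp
    rw [hsplit]
    -- the model lines
    have hLW : ∀ p : FreqMomentum L M, lW p = (((β * (L : ℝ) ^ 2 : ℝ)) : ℂ) * klfb_prop (klWdC Λt) (matsubaraFreq β M p.1) (nambuXiCT L μ K p.2) := by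
      intro p; simp only [hlW, hG, hWd]; exact klfw_sliceLine_eq μ K hβ.ne' hΛpos.ne' p
    have hLΦ : ∀ p : FreqMomentum L M, lΦ p = (((β * (L : ℝ) ^ 2 : ℝ)) : ℂ) * klfb_prop d (matsubaraFreq β M p.1) (nambuXiCT L μ K p.2) := by
      intro p; simp only [hlΦ, hG]; exact hwd p
    -- a slice line outside the `4Λₙ₊₁` window vanishes
    have hLW0 : ∀ p : FreqMomentum L M, (4 * klScale klE0 (n + 1)) ^ 2 < matsubaraFreq β M p.1 ^ 2 →
        klfb_prop (klWdC Λt) (matsubaraFreq β M p.1) (nambuXiCT L μ K p.2) = 0 := by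
      intro p hω
      rw [klfw_klfb_prop_eq μ K hβ.ne', klWdC, ← klfw_Wd_eq_klWd β μ K hΛpos.ne' p, klms_Wd_eq_zero_of_freq β μ K n hlo hhi p hω]
      simp
    -- term B: partner collapse to the frequency one below
    have hB : ∀ p : FreqMomentum L M, lW p * (∑ p' : FreqMomentum L M, if C p p' then lΦ p' * X₀ p.2 p'.2 else 0) =
        (((β * (L : ℝ) ^ 2 : ℝ)) : ℂ) ^ 2 * (X₀ p.2 (p.2 + q) *
          (klfb_prop (klWdC Λt) (matsubaraFreq β M p.1) (nambuXiCT L μ K p.2) *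
            klfb_prop d (matsubaraFreq β M p.1 + -(2 * π / β)) (nambuXiCT L μ K (p.2 + q)))) := by
      intro p
      simp only [hC]
      rw [klmc_sum_ite_crossed_eq Qm x y p (fun p' => lΦ p' * X₀ p.2 p'.2)]
      by_cases hex : ∃ i₀ : MatsubaraIdx M, matsubaraInt M i₀ + 1 = matsubaraInt M p.1
      · obtain ⟨i₀, hi₀⟩ := hex
        rw [klmc_sum_ite_pred_eq hi₀, hLW p, hLΦ (i₀, p.2 + q)]
        have hω : matsubaraFreq β M i₀ = matsubaraFreq β M p.1 + -(2 * π / β) := by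
          rw [matsubaraFreq_eq_sub_of_matsubaraInt_succ β hi₀]; ring
        simp only [hω]
        ring
      · have hex' : ∀ i' : MatsubaraIdx M, matsubaraInt M i' + 1 ≠ matsubaraInt M p.1 := fun i' h => hex ⟨i', h⟩
        rw [klmc_sum_ite_pred_eq_zero hex', hLW p, hLW0 p (klmc_sq_gt_of_val_eq_zero hβ hΛ1.le hM p.1 (klmc_val_eq_zero_of_no_pred hex'))]
        simp
    -- term A: source collapse to the frequency one above
    have hA : ∀ p' : FreqMomentum L M, lW p' * (∑ p : FreqMomentum L M, if C p p' then lΦ p * X₀ p.2 p'.2 else 0) =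
        (((β * (L : ℝ) ^ 2 : ℝ)) : ℂ) ^ 2 * (X₀ (p'.2 + -q) p'.2 *
          (klfb_prop (klWdC Λt) (matsubaraFreq β M p'.1) (nambuXiCT L μ K p'.2) *
            klfb_prop d (matsubaraFreq β M p'.1 + 2 * π / β) (nambuXiCT L μ K (p'.2 + -q)))) := by
      intro p'
      simp only [hC]
      rw [klmc_sum_ite_crossed_eq' Qm x y p' (fun p => lΦ p * X₀ p.2 p'.2)]
      by_cases hex : ∃ i₀ : MatsubaraIdx M, matsubaraInt M p'.1 + 1 = matsubaraInt M i₀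
      · obtain ⟨i₀, hi₀⟩ := hex
        rw [klmc_sum_ite_succ_eq hi₀, hLW p', hLΦ (i₀, p'.2 + -q)]
        have hω : matsubaraFreq β M i₀ = matsubaraFreq β M p'.1 + 2 * π / β := by
          have := matsubaraFreq_eq_sub_of_matsubaraInt_succ β hi₀; linarith
        simp only [hω]
        ring
      · have hex' : ∀ i : MatsubaraIdx M, matsubaraInt M p'.1 + 1 ≠ matsubaraInt M i := fun i h => hex ⟨i, h⟩
        have hzero : (∑ i : MatsubaraIdx M, if matsubaraInt M p'.1 + 1 = matsubaraInt M i then lΦ (i, p'.2 + -(Qm - x - y)) * X₀ (i, p'.2 + -(Qm - x - y)).2 p'.2 else 0) = 0 :=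
          Finset.sum_eq_zero fun i _ => by rw [if_neg (hex' i)]
        rw [hzero, hLW p', hLW0 p' (klmc_sq_gt_of_val_eq_top hβ hΛ1.le hM p'.1 (klmc_val_eq_top_of_no_succ hex'))]
        simp
    rw [Finset.sum_congr rfl fun p _ => hB p, Finset.sum_congr rfl fun p' _ => hA p', ← Finset.mul_sum, ← Finset.mul_sum]
    have hnorm : ‖(((β * (L : ℝ) ^ 2 : ℝ)) : ℂ) ^ 2‖ = (β * (L : ℝ) ^ 2) ^ 2 := by
      rw [norm_pow, Complex.norm_real, Real.norm_of_nonneg (by positivity)]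
    refine (norm_add_le _ _).trans ?_
    rw [norm_mul, norm_mul, hnorm, ← mul_add]
  · ----------------------------------------------------------------- the flat remainder
    have h2πβ : 2 * π / β ≤ klScale klE0 (n + 1) / 8 := by
      have : 2 * π / β = (16 * π / β) / 8 := by ring
      rw [this]; exact div_le_div_of_nonneg_right hβn (by norm_num)
    have hterm : ∀ (p p' : FreqMomentum L M),
        ‖(if C p p' then ln p p' * (X p p' - X₀ p.2 p'.2) else 0)‖ ≤ ε * (if C p p' then ‖ln p p'‖ else 0) := by
      intro p p'
      simp only [hC]
      split_ifs with hc
      · obtain ⟨hω, hk⟩ := (klmc_constraint_iff Qm x y p p').1 hc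
        have hωrel : matsubaraFreq β M p'.1 = matsubaraFreq β M p.1 - 2 * π / β := matsubaraFreq_eq_sub_of_matsubaraInt_succ β hω
        by_cases hwin : matsubaraFreq β M p.1 ^ 2 ≤ (5 * klScale klE0 (n + 1)) ^ 2
        · rw [norm_mul, mul_comm]
          refine mul_le_mul_of_nonneg_right ?_ (norm_nonneg _)
          have h := hflat p.1 p'.1 p.2 p'.2 hω hwin
          simp only [hX, hX₀]
          exact h
        · -- outside the `5Λ` window both slice factors vanish
          have hω5 : (5 * klScale klE0 (n + 1)) ^ 2 < matsubaraFreq β M p.1 ^ 2 := not_le.mp hwin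
          have hωp : (4 * klScale klE0 (n + 1)) ^ 2 < matsubaraFreq β M p.1 ^ 2 := lt_of_le_of_lt (by nlinarith [hΛ1]) hω5
          have hωp' : (4 * klScale klE0 (n + 1)) ^ 2 < matsubaraFreq β M p'.1 ^ 2 := by
            by_contra hle
            have hle' : matsubaraFreq β M p'.1 ^ 2 ≤ (4 * klScale klE0 (n + 1)) ^ 2 := not_lt.mp hle
            have habs : |matsubaraFreq β M p'.1| ≤ 4 * klScale klE0 (n + 1) := abs_le_of_sq_le_sq' hle' (by positivity) |>.2 |> fun h => by
              exact abs_le.2 ⟨(abs_le_of_sq_le_sq' hle' (by positivity)).1, h⟩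
            have habs_p : |matsubaraFreq β M p.1| ≤ 5 * klScale klE0 (n + 1) := by
              have e : matsubaraFreq β M p.1 = matsubaraFreq β M p'.1 + 2 * π / β := by rw [hωrel]; ring
              rw [e]
              refine (abs_add_le _ _).trans ?_
              rw [abs_of_pos (by positivity : (0:ℝ) < 2 * π / β)]
              linarith
            have hsq : matsubaraFreq β M p.1 ^ 2 ≤ (5 * klScale klE0 (n + 1)) ^ 2 := by
              rw [← sq_abs]; exact pow_le_pow_left₀ (abs_nonneg _) habs_p 2
            exact absurd hsq hwin
          have hz : Wd t p = 0 := by simp only [hWd]; exact klms_Wd_eq_zero_of_freq β μ K n hlo hhi p hωp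
          have hz' : Wd t p' = 0 := by simp only [hWd]; exact klms_Wd_eq_zero_of_freq β μ K n hlo hhi p' hωp'
          have hln0 : ln p p' = 0 := by simp only [hln, hlW, hz, hz']; simp
          rw [hln0]
          simp
      · simp
    calc ‖∑ p : FreqMomentum L M, ∑ p' : FreqMomentum L M, (if C p p' then ln p p' * (X p p' - X₀ p.2 p'.2) else 0)‖
        ≤ ∑ p : FreqMomentum L M, ∑ p' : FreqMomentum L M, ε * (if C p p' then ‖ln p p'‖ else 0) :=
          (norm_sum_le _ _).trans (Finset.sum_le_sum fun p _ => (norm_sum_le _ _).trans (Finset.sum_le_sum fun p' _ => hterm p p'))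
      _ = ε * ∑ p : FreqMomentum L M, ∑ p' : FreqMomentum L M, (if C p p' then ‖ln p p'‖ else 0) := by simp only [Finset.mul_sum]
      _ ≤ ε * (256 / 3 * (β * (L : ℝ) ^ 2) ^ 2 / Λt ^ 2 * ∑ p : FreqMomentum L M, |w p| * ‖propCT L M β μ K p‖) := by
          refine mul_le_mul_of_nonneg_left ?_ hε
          have h := crossed_mass_le_softSum β μ K hβ hΛpos w Qm x y
          subst hWd
          simpa only [hC, hln, hlW, hlΦ, hG] using h


/-! ## §2 The adjacent-pair crossed `D`-row `Rx₁`, signed and assembled -/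

section Adjacent

variable {a' b' : ℝ} (B : BandBounds a' b') {R : RenConsts} {U : ℝ} {N : ℕ} {A : ℝ}

/-- **THE ADJACENT-PAIR CROSSED `D`-ROW `Rx₁`, SIGNED AND ASSEMBLED**: pair `(j, n+1)`, `n+1 ≤ j`, `D = s_{n+1,j} − s_{n+1,n+1}`, profile `klPhiC Λ_j Λₙ₊₁`,
`q̃ = Q_m − x − y` with `G|p_q̃|_𝕋 ≤ Λₙ₊₁/8`, `16π/β ≤ Λₙ₊₁`. -/
theorem klms_dLine_adjacent_crossed_signed_le (hR : ∀ j, 0 ≤ R.Gfr j) (hK : FrameOK R U N μ K)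
    (hAb : ∀ p : Momentum, ∀ j ≤ 2, ‖iteratedFDeriv ℝ j (frameShift K) p‖ ≤ A) (hA : 4 * A < B.Dtmin) (hA20 : 4 * A ≤ 1 / 20) (hμ : μ ≤ -0.15)
    (n : ℕ) {t : ℝ} (ht : t ∈ Icc (0 : ℝ) 1) (hβ : klBetaMin ≤ β) (hn : n + 1 ≤ nScales β + 1) (hβn : 16 * π / β ≤ klScale klE0 (n + 1))
    (hM : β * (4 * klScale klE0 (n + 1)) / (2 * Real.pi) + 1 ≤ M)
    (Wd : ℝ → FreqMomentum L M → ℝ) (hWd : Wd = fun t k => deriv (fun Λ' : ℝ => hubbardCutoffWeightCT L M β μ K Λ' k) (klScale klE0 n + t * (klScale klE0 (n + 1) - klScale klE0 n)))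
    (V : ℕ → ℝ → (Fin 4 → HubbardFieldIdx L M) → ℂ) {j : ℕ} (hj : n + 1 ≤ j) (Qm x y : TorusSite 2 L)
    (hlo : a' < μ - 4 * klScale klE0 (n + 1) - 4 * A) (hhi : μ + 4 * klScale klE0 (n + 1) + 4 * A < b')
    (hq : (4 + 8 / 3 * R.Gfr 1 * U ^ 2) * klTorusNorm L (Qm - x - y) ≤ klScale klE0 (n + 1) / 8)
    {A₀ LA ε : ℝ} (hA0 : 0 ≤ A₀) (hLA : 0 ≤ LA) (hε : 0 ≤ ε)
    (hY0B : ∀ k : TorusSite 2 L, ‖V j t ![(((omega0 M, k), 0), 1), ((((omega0 M).rev, k + (Qm - x - y)), 1), 0), (((omega0 M, y), 0), 0), ((((omega0 M).rev, Qm - x), 1), 1)] *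
        V j t ![(((omega0 M, k), 0), 0), ((((omega0 M).rev, k + (Qm - x - y)), 1), 1), ((((omega0 M).rev, Qm - y), 1), 0), (((omega0 M, x), 0), 1)]‖ ≤ A₀)
    (hY1B : ∀ k k' : TorusSite 2 L,
      ‖V j t ![(((omega0 M, k), 0), 1), ((((omega0 M).rev, k + (Qm - x - y)), 1), 0), (((omega0 M, y), 0), 0), ((((omega0 M).rev, Qm - x), 1), 1)] *
            V j t ![(((omega0 M, k), 0), 0), ((((omega0 M).rev, k + (Qm - x - y)), 1), 1), ((((omega0 M).rev, Qm - y), 1), 0), (((omega0 M, x), 0), 1)] -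
          V j t ![(((omega0 M, k'), 0), 1), ((((omega0 M).rev, k' + (Qm - x - y)), 1), 0), (((omega0 M, y), 0), 0), ((((omega0 M).rev, Qm - x), 1), 1)] *
            V j t ![(((omega0 M, k'), 0), 0), ((((omega0 M).rev, k' + (Qm - x - y)), 1), 1), ((((omega0 M).rev, Qm - y), 1), 0), (((omega0 M, x), 0), 1)]‖ ≤
        LA * klTorusNorm L (k - k'))
    (hY0A : ∀ k : TorusSite 2 L, ‖V j t ![(((omega0 M, k + -(Qm - x - y)), 0), 1), ((((omega0 M).rev, k), 1), 0), (((omega0 M, y), 0), 0), ((((omega0 M).rev, Qm - x), 1), 1)] *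
        V j t ![(((omega0 M, k + -(Qm - x - y)), 0), 0), ((((omega0 M).rev, k), 1), 1), ((((omega0 M).rev, Qm - y), 1), 0), (((omega0 M, x), 0), 1)]‖ ≤ A₀)
    (hY1A : ∀ k k' : TorusSite 2 L,
      ‖V j t ![(((omega0 M, k + -(Qm - x - y)), 0), 1), ((((omega0 M).rev, k), 1), 0), (((omega0 M, y), 0), 0), ((((omega0 M).rev, Qm - x), 1), 1)] *
            V j t ![(((omega0 M, k + -(Qm - x - y)), 0), 0), ((((omega0 M).rev, k), 1), 1), ((((omega0 M).rev, Qm - y), 1), 0), (((omega0 M, x), 0), 1)] -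
          V j t ![(((omega0 M, k' + -(Qm - x - y)), 0), 1), ((((omega0 M).rev, k'), 1), 0), (((omega0 M, y), 0), 0), ((((omega0 M).rev, Qm - x), 1), 1)] *
            V j t ![(((omega0 M, k' + -(Qm - x - y)), 0), 0), ((((omega0 M).rev, k'), 1), 1), ((((omega0 M).rev, Qm - y), 1), 0), (((omega0 M, x), 0), 1)]‖ ≤
        LA * klTorusNorm L (k - k'))
    (hflat : ∀ (i i' : MatsubaraIdx M) (k k' : TorusSite 2 L), matsubaraInt M i' + 1 = matsubaraInt M i →
      matsubaraFreq β M i ^ 2 ≤ (5 * klScale klE0 (n + 1)) ^ 2 →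
      ‖V j t ![(((i, k), 0), 1), (((i', k'), 1), 0), (((omega0 M, y), 0), 0), ((((omega0 M).rev, Qm - x), 1), 1)] *
            V j t ![(((i, k), 0), 0), (((i', k'), 1), 1), ((((omega0 M).rev, Qm - y), 1), 0), (((omega0 M, x), 0), 1)] -
          V j t ![(((omega0 M, k), 0), 1), ((((omega0 M).rev, k'), 1), 0), (((omega0 M, y), 0), 0), ((((omega0 M).rev, Qm - x), 1), 1)] *
            V j t ![(((omega0 M, k), 0), 0), ((((omega0 M).rev, k'), 1), 1), ((((omega0 M).rev, Qm - y), 1), 0), (((omega0 M, x), 0), 1)]‖ ≤ ε) :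
    ‖∑ p : FreqMomentum L M, ∑ p' : FreqMomentum L M,
        if matsubaraInt M p'.1 + matsubaraInt M (omega0 M) + matsubaraInt M (omega0 M) + 1 = matsubaraInt M p.1 ∧ p'.2 = p.2 + Qm - x - y then
          ((((((softSymbolCompl L M β μ K (n + 1) j p - softSymbolCompl L M β μ K (n + 1) (n + 1) p) : ℝ) : ℂ) * (((β * (L : ℝ) ^ 2 : ℝ) : ℂ) * propCT L M β μ K p)) *
                ((((Wd t p') : ℝ) : ℂ) * (((β * (L : ℝ) ^ 2 : ℝ) : ℂ) * propCT L M β μ K p'))) +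
              (((((Wd t p) : ℝ) : ℂ) * (((β * (L : ℝ) ^ 2 : ℝ) : ℂ) * propCT L M β μ K p)) *
                ((((softSymbolCompl L M β μ K (n + 1) j p' - softSymbolCompl L M β μ K (n + 1) (n + 1) p') : ℝ) : ℂ) * (((β * (L : ℝ) ^ 2 : ℝ) : ℂ) * propCT L M β μ K p')))) *
            (V j t ![((p, 0), 1), ((p', 1), 0), (((omega0 M, y), 0), 0), ((((omega0 M).rev, Qm - x), 1), 1)] *
              V j t ![((p, 0), 0), ((p', 1), 1), ((((omega0 M).rev, Qm - y), 1), 0), (((omega0 M, x), 0), 1)])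
        else 0‖ ≤
      (β * (L : ℝ) ^ 2) ^ 2 *
          (β * (L : ℝ) ^ 2 * klmsRowBound B.Dtmin A (4 + 8 / 3 * R.Gfr 1 * U ^ 2) A₀ LA β n j
              (|-(2 * π / β)| + (4 + 8 / 3 * R.Gfr 1 * U ^ 2) * klTorusNorm L (Qm - x - y)) L +
            β * (L : ℝ) ^ 2 * klmsRowBound B.Dtmin A (4 + 8 / 3 * R.Gfr 1 * U ^ 2) A₀ LA β n j
              (|2 * π / β| + (4 + 8 / 3 * R.Gfr 1 * U ^ 2) * klTorusNorm L (Qm - x - y)) L) +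
        ε * (256 / 3 * (β * (L : ℝ) ^ 2) ^ 2 / (klScale klE0 n + t * (klScale klE0 (n + 1) - klScale klE0 n)) ^ 2 *
          ∑ p : FreqMomentum L M, |softSymbolCompl L M β μ K (n + 1) j p - softSymbolCompl L M β μ K (n + 1) (n + 1) p| * ‖propCT L M β μ K p‖) := by
  have hβ0 : 0 < β := lt_of_lt_of_le (by norm_num [klBetaMin]) hβ
  have hhi1 : klScale klE0 (n + 1) ≤ klScale klE0 n := by rw [klth_klScale_succ]; linarith [klth_klScale_pos n]
  have h0 := klms_weighted_crossed_norm_le β μ K hβ0 n ht hβn hM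
    (fun p => softSymbolCompl L M β μ K (n + 1) j p - softSymbolCompl L M β μ K (n + 1) (n + 1) p)
    (klPhiC (klScale klE0 j) (klScale klE0 (n + 1))) (fun p => klfw_dLine_line_eq μ K hβ0.ne' n j (n + 1) p) Wd hWd
    (fun p p' => V j t ![((p, 0), 1), ((p', 1), 0), (((omega0 M, y), 0), 0), ((((omega0 M).rev, Qm - x), 1), 1)] *
      V j t ![((p, 0), 0), ((p', 1), 1), ((((omega0 M).rev, Qm - y), 1), 0), (((omega0 M, x), 0), 1)])
    (fun k k' => V j t ![(((omega0 M, k), 0), 1), ((((omega0 M).rev, k'), 1), 0), (((omega0 M, y), 0), 0), ((((omega0 M).rev, Qm - x), 1), 1)] *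
      V j t ![(((omega0 M, k), 0), 0), ((((omega0 M).rev, k'), 1), 1), ((((omega0 M).rev, Qm - y), 1), 0), (((omega0 M, x), 0), 1)])
    Qm x y hε hflat
  have h2π : |2 * π / β| ≤ klScale klE0 (n + 1) / 8 := by
    rw [abs_of_pos (by positivity)]
    have : 2 * π / β = (16 * π / β) / 8 := by ring
    rw [this]; exact div_le_div_of_nonneg_right hβn (by norm_num)
  have h2π' : |-(2 * π / β)| ≤ klScale klE0 (n + 1) / 8 := by rw [abs_neg]; exact h2π
  have h1 := klms_pinned_bubble_norm_le_gen β μ K B hR hK hAb hA hA20 hμ n ht hj le_rfl hhi1 hlo hhi hβ hn hM (Qm - x - y) hq h2π' hA0 hLA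
    (Y := fun k : TorusSite 2 L =>
      V j t ![(((omega0 M, k), 0), 1), ((((omega0 M).rev, k + (Qm - x - y)), 1), 0), (((omega0 M, y), 0), 0), ((((omega0 M).rev, Qm - x), 1), 1)] *
        V j t ![(((omega0 M, k), 0), 0), ((((omega0 M).rev, k + (Qm - x - y)), 1), 1), ((((omega0 M).rev, Qm - y), 1), 0), (((omega0 M, x), 0), 1)])
    hY0B hY1B
  have hq' : (4 + 8 / 3 * R.Gfr 1 * U ^ 2) * klTorusNorm L (-(Qm - x - y)) ≤ klScale klE0 (n + 1) / 8 := by rwa [klTorusNorm_neg]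
  have h2 := klms_pinned_bubble_norm_le_gen β μ K B hR hK hAb hA hA20 hμ n ht hj le_rfl hhi1 hlo hhi hβ hn hM (-(Qm - x - y)) hq' h2π hA0 hLA
    (Y := fun k : TorusSite 2 L =>
      V j t ![(((omega0 M, k + -(Qm - x - y)), 0), 1), ((((omega0 M).rev, k), 1), 0), (((omega0 M, y), 0), 0), ((((omega0 M).rev, Qm - x), 1), 1)] *
        V j t ![(((omega0 M, k + -(Qm - x - y)), 0), 0), ((((omega0 M).rev, k), 1), 1), ((((omega0 M).rev, Qm - y), 1), 0), (((omega0 M, x), 0), 1)])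
    hY0A hY1A
  rw [klTorusNorm_neg] at h2
  exact h0.trans (add_le_add (mul_le_mul_of_nonneg_left (add_le_add h1 h2) (by positivity)) le_rfl)

end Adjacent

end Summit.HubbardSuperconductivity.HubbardSuperconductivity.Theorems.KLRegimeSplit

end
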